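import Summits.Ventures.QEC.CircuitDistance.PortNormal
import HarnessLib

/-!
# P3-PORT (C2): NORMALISATION of fault sets, monotonicity in `Nc`, and the GAP lemma (cell `qec`, experiment CDX, seat
# qec-cdx-type-1)

* column bookkeeping `sameCols_erase_zero` / `sameCols_erase_pair` / `sameCols_trade`, `transfer_sameCols`;
* **`exists_normal`**: every undetectable logical fault set of the `Nc`-circuit is matched by a NORMAL one with no more faulty
  operations (drop `InitZ@Nc`, trade `InitZ@c` for `MeasZ@(c+1)`, cancelling against an existing one);
* **`hasAt_mono_cycles`**: `Nc ≤ Nc' → HasAt S Nc w → HasAt S Nc' w`;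
* **`undetectable_split`** (GAP LEMMA): splitting a normal undetectable set at a fault-free cycle gives two undetectable
  sets (δ = 1 locality).
Generic in `S`; nothing here asserts a value of `d_circ`.
-/

namespace Summit.Ventures.QEC.CircuitDistance

open Literature.InformationTheory.QuantumCodes

variable {ℓ m : ℕ} [NeZero ℓ] [NeZero m]

/-! ### Elementary column bookkeeping -/

/-- Removing a zero column keeps all columns of the set. -/
theorem sameCols_erase_zero (S : SMCode ℓ m) (Nc : ℕ) (F : Finset (Fault ℓ m)) {f : Fault ℓ m} (hf : f ∈ F)
    (h0 : SameCols S Nc {f} ∅) : SameCols S Nc F (F.erase f) := by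
  obtain ⟨hX, hZ, hdX, hdZ⟩ := h0
  have hX' : ∀ t i, detX S Nc {f} t i = false := fun t i => by rw [← hX t i, detX_eq_bsum]; exact bsum_empty _
  have hZ' : ∀ t j, detZ S Nc {f} t j = false := fun t j => by rw [← hZ t j, detZ_eq_bsum]; exact bsum_empty _
  have hdX' : dataX S Nc {f} = 0 := by rw [← hdX, dataX_eq_sum, Finset.sum_empty]
  have hdZ' : dataZ S Nc {f} = 0 := by rw [← hdZ, dataZ_eq_sum, Finset.sum_empty]
  have hF : F = insert f (F.erase f) := (Finset.insert_erase hf).symm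
  refine ⟨fun t i => ?_, fun t j => ?_, ?_, ?_⟩
  · conv_rhs => rw [hF]
    rw [detX_eq_bsum, detX_eq_bsum S Nc (insert f _), bsum_insert (Finset.notMem_erase f F), hX', Bool.false_xor]
  · conv_rhs => rw [hF]
    rw [detZ_eq_bsum, detZ_eq_bsum S Nc (insert f _), bsum_insert (Finset.notMem_erase f F), hZ', Bool.false_xor]
  · conv_rhs => rw [hF]
    rw [dataX_eq_sum, dataX_eq_sum S Nc (insert f _), Finset.sum_insert (Finset.notMem_erase f F), hdX', zero_add]
  · conv_rhs => rw [hF]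
    rw [dataZ_eq_sum, dataZ_eq_sum S Nc (insert f _), Finset.sum_insert (Finset.notMem_erase f F), hdZ', zero_add]

omit [NeZero ℓ] [NeZero m] in
/-- In `ZMod 2`-valued functions, `v + v + w = w`. -/
theorem add_self_add (v w : BB.Mono ℓ m ⊕ BB.Mono ℓ m → ZMod 2) : v + (v + w) = w := by
  funext q; simp only [Pi.add_apply]
  have : ∀ a b : ZMod 2, a + (a + b) = b := by decide
  exact this _ _

/-- Removing two equal columns keeps all columns of the set. -/
theorem sameCols_erase_pair (S : SMCode ℓ m) (Nc : ℕ) (F : Finset (Fault ℓ m)) {f g : Fault ℓ m} (hf : f ∈ F) (hg : g ∈ F)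
    (hne : f ≠ g) (hfg : SameCols S Nc {f} {g}) : SameCols S Nc F ((F.erase f).erase g) := by
  obtain ⟨hX, hZ, hdX, hdZ⟩ := hfg
  have hgR : g ∈ F.erase f := Finset.mem_erase.2 ⟨hne.symm, hg⟩
  have hF : F = insert f (insert g ((F.erase f).erase g)) := by rw [Finset.insert_erase hgR, Finset.insert_erase hf]
  have hf' : f ∉ insert g ((F.erase f).erase g) := by
    rw [Finset.mem_insert, not_or]; exact ⟨hne, fun h => (Finset.mem_erase.1 (Finset.mem_of_mem_erase h)).1 rfl⟩
  have hg' : g ∉ (F.erase f).erase g := Finset.notMem_erase g _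
  refine ⟨fun t i => ?_, fun t j => ?_, ?_, ?_⟩
  · conv_rhs => rw [hF]
    rw [detX_eq_bsum, detX_eq_bsum S Nc (insert f _), bsum_insert hf', bsum_insert hg']
    rw [show detX S Nc {f} t i = detX S Nc {g} t i by rw [← hX t i]]
    cases detX S Nc {g} t i <;> simp
  · conv_rhs => rw [hF]
    rw [detZ_eq_bsum, detZ_eq_bsum S Nc (insert f _), bsum_insert hf', bsum_insert hg']
    rw [show detZ S Nc {f} t j = detZ S Nc {g} t j by rw [← hZ t j]]
    cases detZ S Nc {g} t j <;> simp
  · conv_rhs => rw [hF]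
    rw [dataX_eq_sum, dataX_eq_sum S Nc (insert f _), Finset.sum_insert hf', Finset.sum_insert hg', ← hdX, add_self_add]
  · conv_rhs => rw [hF]
    rw [dataZ_eq_sum, dataZ_eq_sum S Nc (insert f _), Finset.sum_insert hf', Finset.sum_insert hg', ← hdZ, add_self_add]

/-- Trading a fault for an absent fault with the same column keeps all columns of the set. -/
theorem sameCols_trade (S : SMCode ℓ m) (Nc : ℕ) (F : Finset (Fault ℓ m)) {f g : Fault ℓ m} (hf : f ∈ F) (hg : g ∉ F)
    (hfg : SameCols S Nc {f} {g}) : SameCols S Nc F (insert g (F.erase f)) := by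
  obtain ⟨hX, hZ, hdX, hdZ⟩ := hfg
  have hF : F = insert f (F.erase f) := (Finset.insert_erase hf).symm
  have hg' : g ∉ F.erase f := fun h => hg (Finset.mem_of_mem_erase h)
  refine ⟨fun t i => ?_, fun t j => ?_, ?_, ?_⟩
  · conv_rhs => rw [hF]
    rw [detX_eq_bsum, detX_eq_bsum S Nc (insert f _), bsum_insert hg', bsum_insert (Finset.notMem_erase f F), hX]
  · conv_rhs => rw [hF]
    rw [detZ_eq_bsum, detZ_eq_bsum S Nc (insert f _), bsum_insert hg', bsum_insert (Finset.notMem_erase f F), hZ]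
  · conv_rhs => rw [hF]
    rw [dataX_eq_sum, dataX_eq_sum S Nc (insert f _), Finset.sum_insert hg', Finset.sum_insert (Finset.notMem_erase f F), hdX]
  · conv_rhs => rw [hF]
    rw [dataZ_eq_sum, dataZ_eq_sum S Nc (insert f _), Finset.sum_insert hg', Finset.sum_insert (Finset.notMem_erase f F), hdZ]

/-- `SameCols` transports undetectability and logical error (the event clause is supplied separately). -/
theorem transfer_sameCols (S : SMCode ℓ m) (Nc : ℕ) {F F' : Finset (Fault ℓ m)} (h : SameCols S Nc F F')
    (hev : ∀ f ∈ F', f.ev ∈ allEvents Nc) (hU : Undetectable S Nc F) (hL : LogicalError S Nc F) :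
    Undetectable S Nc F' ∧ LogicalError S Nc F' := by
  obtain ⟨hX, hZ, hdX, hdZ⟩ := h
  refine ⟨⟨hev, fun t i => ⟨?_, ?_⟩⟩, ?_⟩
  · rw [hX]; exact (hU.2 t i).1
  · rw [hZ]; exact (hU.2 t i).2
  · unfold LogicalError at hL ⊢; rw [hdX, hdZ]; exact hL

omit [NeZero ℓ] [NeZero m] in
/-- The only fault on an `InitZ` location is that `InitZ` fault. -/
theorem eq_initZ_of_loc_eq {f : Fault ℓ m} {c : ℕ} {j : BB.Mono ℓ m} (h : f.loc = (Fault.initZ c j).loc) :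
    f = Fault.initZ c j := by
  cases f <;> simp_all [Fault.loc]

/-- **NORMALISATION.** Every undetectable logical fault set of the `Nc`-circuit is matched by a NORMAL one with no more
faulty operations. -/
theorem exists_normal (S : SMCode ℓ m) (Nc : ℕ) (F : Finset (Fault ℓ m)) (hU : Undetectable S Nc F)
    (hL : LogicalError S Nc F) :
    ∃ F' : Finset (Fault ℓ m), Normal Nc F' ∧ Undetectable S Nc F' ∧ LogicalError S Nc F' ∧
      faultCount F' ≤ faultCount F := by
  classical
  induction hn : (F.filter fun f => f.isInitZ = true).card using Nat.strong_induction_on generalizing F with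
  | _ n ih =>
    by_cases h0 : (F.filter fun f => f.isInitZ = true) = ∅
    · refine ⟨F, fun f hf => ?_, hU, hL, le_rfl⟩
      have hev := hU.1 f hf
      rw [mem_allEvents_iff, Fault.ev_cyc] at hev
      refine ⟨hev.1, hev.2, ?_⟩
      by_contra hI
      have : f ∈ F.filter fun f => f.isInitZ = true := Finset.mem_filter.2 ⟨hf, by simpa using hI⟩
      rw [h0] at this; simp at this
    · obtain ⟨f, hfF⟩ := Finset.nonempty_iff_ne_empty.2 h0
      obtain ⟨hf, hfI⟩ := Finset.mem_filter.1 hfF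
      -- `f` is an `InitZ` fault in the circuit
      obtain ⟨c, j, rfl⟩ : ∃ c j, f = Fault.initZ c j := by
        cases f <;> simp [Fault.isInitZ] at hfI; exact ⟨_, _, rfl⟩
      have hev := hU.1 _ hf
      rw [mem_allEvents_iff, Fault.ev_cyc] at hev
      change 1 ≤ c ∧ c ≤ Nc at hev
      -- count of InitZ faults drops in all three replacements
      have hcount_erase : ((F.erase (Fault.initZ c j)).filter fun f => f.isInitZ = true).card < n := by
        rw [Finset.filter_erase, Finset.card_erase_of_mem hfF]; have := Finset.card_pos.2 ⟨_, hfF⟩; omega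
      by_cases hlast : c = Nc
      · -- zero column: drop it
        subst hlast
        have hsc := sameCols_erase_zero S c F hf (initZ_last_sameCols S c j hev.1)
        obtain ⟨hU₁, hL₁⟩ := transfer_sameCols S c hsc (fun g hg => hU.1 g (Finset.mem_of_mem_erase hg)) hU hL
        obtain ⟨F', hN', hU', hL', hc'⟩ := ih _ hcount_erase (F.erase (Fault.initZ c j)) hU₁ hL₁ rfl
        exact ⟨F', hN', hU', hL', hc'.trans (Finset.card_le_card (Finset.image_subset_image (Finset.erase_subset _ _)))⟩
      · have hc1 : c + 1 ≤ Nc := by omega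
        have hsc := initZ_measZ_sameCols S Nc c j hev.1 hc1
        set g : Fault ℓ m := Fault.measZ (c + 1) j with hg
        have hgev : g.ev ∈ allEvents Nc := by rw [mem_allEvents_iff, Fault.ev_cyc]; change 1 ≤ c + 1 ∧ c + 1 ≤ Nc; omega
        have hne : Fault.initZ c j ≠ g := by rw [hg]; simp
        by_cases hgF : g ∈ F
        · -- both present: they cancel
          have hsc2 := sameCols_erase_pair S Nc F hf hgF hne hsc
          obtain ⟨hU₁, hL₁⟩ := transfer_sameCols S Nc hsc2
            (fun x hx => hU.1 x (Finset.mem_of_mem_erase (Finset.mem_of_mem_erase hx))) hU hL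
          have hlt : (((F.erase (Fault.initZ c j)).erase g).filter fun f => f.isInitZ = true).card < n := by
            refine lt_of_le_of_lt (Finset.card_le_card (Finset.filter_subset_filter _ (Finset.erase_subset _ _))) hcount_erase
          obtain ⟨F', hN', hU', hL', hc'⟩ := ih _ hlt _ hU₁ hL₁ rfl
          refine ⟨F', hN', hU', hL', hc'.trans (Finset.card_le_card (Finset.image_subset_image ?_))⟩
          exact (Finset.erase_subset _ _).trans (Finset.erase_subset _ _)
        · -- trade InitZ@c for MeasZ@(c+1)
          have hsc2 := sameCols_trade S Nc F hf hgF hsc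
          obtain ⟨hU₁, hL₁⟩ := transfer_sameCols S Nc hsc2 (fun x hx => by
            rcases Finset.mem_insert.1 hx with rfl | hx
            · exact hgev
            · exact hU.1 x (Finset.mem_of_mem_erase hx)) hU hL
          have hlt : ((insert g (F.erase (Fault.initZ c j))).filter fun f => f.isInitZ = true).card < n := by
            rw [Finset.filter_insert, if_neg (by rw [hg]; simp [Fault.isInitZ])]; exact hcount_erase
          obtain ⟨F', hN', hU', hL', hc'⟩ := ih _ hlt _ hU₁ hL₁ rfl
          refine ⟨F', hN', hU', hL', hc'.trans ?_⟩
          -- faultCount (insert g (F.erase f)) ≤ faultCount F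
          unfold faultCount
          rw [Finset.image_insert]
          have hsub : (F.erase (Fault.initZ c j)).image Fault.loc ⊆ (F.image Fault.loc).erase (Fault.initZ c j).loc := by
            intro x hx
            obtain ⟨y, hy, rfl⟩ := Finset.mem_image.1 hx
            refine Finset.mem_erase.2 ⟨fun h => ?_, Finset.mem_image_of_mem _ (Finset.mem_of_mem_erase hy)⟩
            exact (Finset.mem_erase.1 hy).1 (eq_initZ_of_loc_eq h)
          calc (insert g.loc ((F.erase (Fault.initZ c j)).image Fault.loc)).card
              ≤ ((F.erase (Fault.initZ c j)).image Fault.loc).card + 1 := Finset.card_insert_le _ _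
            _ ≤ ((F.image Fault.loc).erase (Fault.initZ c j).loc).card + 1 := by
                have := Finset.card_le_card hsub; omega
            _ = (F.image Fault.loc).card := by
                rw [Finset.card_erase_of_mem (Finset.mem_image_of_mem _ hf)]
                have := Finset.card_pos.2 ⟨_, Finset.mem_image_of_mem Fault.loc hf⟩; omega

/-- **Monotonicity in `Nc`.** A longer circuit contains every undetectable logical fault set of a shorter one (after
normalisation). -/
theorem hasAt_mono_cycles (S : SMCode ℓ m) {Nc Nc' : ℕ} (h : Nc ≤ Nc') (w : ℕ) :
    HasLogicalFaultOfWeightAtMostAt S Nc w → HasLogicalFaultOfWeightAtMostAt S Nc' w := by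
  rintro ⟨F, hU, hL, hw⟩
  obtain ⟨F', hN, hU', hL', hc⟩ := exists_normal S Nc F hU hL
  obtain ⟨hU'', hL''⟩ := transfer_normal S F' hN (fun f hf => (hN f hf).2.1.trans h) hU' hL'
  exact ⟨F', hU'', hL'', hc.trans hw⟩

/-! ## Gap, shift, truncate -/

/-- GAP LEMMA: splitting a normal undetectable set at a fault-free cycle `s` gives two undetectable sets. -/
theorem undetectable_split (S : SMCode ℓ m) (Nc : ℕ) (F : Finset (Fault ℓ m)) (hN : Normal Nc F)
    (hU : Undetectable S Nc F) (s : ℕ) (hs : ∀ f ∈ F, f.cyc ≠ s) :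
    Undetectable S Nc (F.filter fun f => f.cyc < s) ∧ Undetectable S Nc (F.filter fun f => s < f.cyc) := by
  classical
  set A := F.filter fun f => f.cyc < s
  set B := F.filter fun f => s < f.cyc
  have hAB : Disjoint A B := by
    rw [Finset.disjoint_filter]; intro f _ h1 h2; omega
  have hF : F = A ∪ B := by
    ext f; simp only [A, B, Finset.mem_union, Finset.mem_filter]
    constructor
    · intro hf; rcases Nat.lt_or_gt_of_ne (hs f hf) with h | h
      · exact Or.inl ⟨hf, h⟩
      · exact Or.inr ⟨hf, h⟩
    · rintro (⟨hf, -⟩ | ⟨hf, -⟩) <;> exact hf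
  -- detectors of each half vanish on the other half's layers
  have hBlow : ∀ t, t ≤ s → (∀ i, detX S Nc B t i = false) ∧ (∀ j, detZ S Nc B t j = false) := by
    intro t ht
    refine ⟨fun i => ?_, fun j => ?_⟩
    · rw [detX_eq_bsum, bsum_congr (h := fun _ => false) (fun f hf => ?_)]; exact bsum_false _
      have hf' := Finset.mem_filter.1 hf
      exact detX_local S Nc f (hN f hf'.1).1 (hN f hf'.1).2.1 ⟨by omega, by omega⟩ i
    · rw [detZ_eq_bsum, bsum_congr (h := fun _ => false) (fun f hf => ?_)]; exact bsum_false _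
      have hf' := Finset.mem_filter.1 hf
      exact detZ_local S Nc f (hN f hf'.1).2.2 (hN f hf'.1).1 (hN f hf'.1).2.1 ⟨by omega, by omega⟩ j
  have hAhigh : ∀ t, s < t → (∀ i, detX S Nc A t i = false) ∧ (∀ j, detZ S Nc A t j = false) := by
    intro t ht
    refine ⟨fun i => ?_, fun j => ?_⟩
    · rw [detX_eq_bsum, bsum_congr (h := fun _ => false) (fun f hf => ?_)]; exact bsum_false _
      have hf' := Finset.mem_filter.1 hf
      exact detX_local S Nc f (hN f hf'.1).1 (hN f hf'.1).2.1 ⟨by omega, by omega⟩ i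
    · rw [detZ_eq_bsum, bsum_congr (h := fun _ => false) (fun f hf => ?_)]; exact bsum_false _
      have hf' := Finset.mem_filter.1 hf
      exact detZ_local S Nc f (hN f hf'.1).2.2 (hN f hf'.1).1 (hN f hf'.1).2.1 ⟨by omega, by omega⟩ j
  have hsumX : ∀ t i, detX S Nc F t i = xor (detX S Nc A t i) (detX S Nc B t i) := by
    intro t i; rw [hF, detX_eq_bsum, detX_eq_bsum S Nc A, detX_eq_bsum S Nc B]; unfold bsum
    rw [Finset.filter_union, Finset.card_union_of_disjoint (Finset.disjoint_filter_filter hAB)]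
    rcases Nat.mod_two_eq_zero_or_one (A.filter fun f => detX S Nc {f} t i = true).card with ha | ha <;>
    rcases Nat.mod_two_eq_zero_or_one (B.filter fun f => detX S Nc {f} t i = true).card with hb | hb <;>
    simp [Nat.add_mod, ha, hb]
  have hsumZ : ∀ t j, detZ S Nc F t j = xor (detZ S Nc A t j) (detZ S Nc B t j) := by
    intro t j; rw [hF, detZ_eq_bsum, detZ_eq_bsum S Nc A, detZ_eq_bsum S Nc B]; unfold bsum
    rw [Finset.filter_union, Finset.card_union_of_disjoint (Finset.disjoint_filter_filter hAB)]
    rcases Nat.mod_two_eq_zero_or_one (A.filter fun f => detZ S Nc {f} t j = true).card with ha | ha <;>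
    rcases Nat.mod_two_eq_zero_or_one (B.filter fun f => detZ S Nc {f} t j = true).card with hb | hb <;>
    simp [Nat.add_mod, ha, hb]
  have hevA : ∀ f ∈ A, f.ev ∈ allEvents Nc := fun f hf => hU.1 f (Finset.mem_filter.1 hf).1
  have hevB : ∀ f ∈ B, f.ev ∈ allEvents Nc := fun f hf => hU.1 f (Finset.mem_filter.1 hf).1
  refine ⟨⟨hevA, fun t i => ⟨?_, ?_⟩⟩, ⟨hevB, fun t i => ⟨?_, ?_⟩⟩⟩
  · rcases Nat.lt_or_ge s t with ht | ht
    · exact (hAhigh t ht).1 i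
    · have := (hU.2 t i).1; rw [hsumX, (hBlow t ht).1 i, Bool.xor_false] at this; exact this
  · rcases Nat.lt_or_ge s t with ht | ht
    · exact (hAhigh t ht).2 i
    · have := (hU.2 t i).2; rw [hsumZ, (hBlow t ht).2 i, Bool.xor_false] at this; exact this
  · rcases Nat.lt_or_ge s t with ht | ht
    · have := (hU.2 t i).1; rw [hsumX, (hAhigh t ht).1 i, Bool.false_xor] at this; exact this
    · exact (hBlow t ht).1 i
  · rcases Nat.lt_or_ge s t with ht | ht
    · have := (hU.2 t i).2; rw [hsumZ, (hAhigh t ht).2 i, Bool.false_xor] at this; exact this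
    · exact (hBlow t ht).2 i

end Summit.Ventures.QEC.CircuitDistance
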